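import Summits.QuantumFields.BalabanUV.Beta.GAN24.CochainProlongation
import Summits.QuantumFields.BalabanUV.Beta.GAN24.MonotoneSqueeze
import Summits.QuantumFields.BalabanUV.Beta.GAN24.MonotoneTorusEffective

/-!
# Beta / GAN24 / MonotoneTorusSqueeze — THE SQUEEZE ON ROAD P4's TORUS AVATAR: the one-step gap of Bałaban's effective actions
# `0 ≤ effAction (j+1) − effAction j` is controlled by the ROW DEFECT of the cochain-prolongated level-`j` minimiser read through the level-`(j+1)` rows
# (1.18), `re⟨B,(E_{j+1} − E_j)B⟩ ≤ −2re⟨B, E_{j+1}(R_j B)⟩`, and the prolongated minimiser is within the same form of the level-`(j+1)` minimiser in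
# ENERGY — `MonotoneSqueeze` instantiated with `CochainProlongation` ((PROL) proved) and `effAction_step_mono` ((MONO), road P4): candidate route R1 of
# `HOME/beta/ROUTES-GAN24.md` v1 CLOSED MODULO ONE ESTIMATE (the size of `R_j`, its S3+S4), every `d`, torus, `Lc`, hypothesis-free
# (binder row G-an2-4 ∕ (CONV-C); road P2 seat gan24-p2 gen 28; NOT IN PRINT — our proof attempt)

HONEST FRAMING (page 1 of everything the β sub-cell writes): discharging `BetaPertH` makes Bałaban's UV stability UNCONDITIONAL — a
real constructive-QFT result; it is NOT the continuum limit and NOT the Clay problem.  HONEST DEPENDENCY (cell reorg 2026-08-19, verbatim):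
«continuum YM on T⁴ ⇐ BetaPertH ∧ nine spine estimates (0/9 proved); BetaPertH ⇐ (D1) ∧ (D4) ∧ CAP+tail; G-an2-4 gates asym, D1 and NE2/3/4.»
HONEST LABEL: «not in print; our proof attempt»; 0 wall binders instantiated; NEVER «G-an2-4 closed».

ABSOLUTE RULE (cell charter, verbatim): "No internally-minted statement may enter as a cited fact. Every hypothesis is either
kernel-proved in this package or a verbatim quotation of a PUBLISHED theorem with page reference. The manuscript(s) under audit are
NOT citable for their own disputed steps — they are the thing under adjudication; programme-internal (2001/route/tribunal) claims
are never citable."  Nothing is cited; [folklore] plumbing over `GAN24/MonotoneSqueeze` (abstract squeeze), `GAN24/CochainProlongation` (`Pco`,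
`curlEnergy_Pco_le`), road P4's `MonotoneTorusTower`∕`MonotoneTorusEffective` (`hform`, `sread`, `effAction`, `effAction_step_mono`) and the tree's `recast`
(`B5Composition116`) BY NAME; no `def … : Prop`.

## WHAT IS PROVED (0 sorry)
* §1 `castS j : Tor (fine (Lc·Lc^j) M) ≃ Tor (fine (Lc^j·Lc) M)` (the prolongation's fine torus IS level `j+1`), `PcoLev j` (the cochain prolongation read on
  `Lev (j+1)`), `curlEnergy_PcoLev_le`, **`prol`**: `re⟨PcoLev A, hform (j+1) PcoLev A⟩ ≤ re⟨A, hform j A⟩` — (PROL) for road P4's scaled curl forms.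
* §2 `PcoMat j` (the matrix of `PcoLev j`), `PcoMat_mulVec`.
* §3 **`Rco j := rowDefect (hform j) (sread j) (Jlift) (sread (j+1)) (PcoMat j)`** — Bałaban's level-`(j+1)` rows of the prolongated level-`j` minimiser, minus one;
  **`effAction_squeeze`**: `0 ≤ re⟨B,(effAction (j+1) − effAction j)B⟩ ≤ −2·re⟨B, effAction (j+1) (Rco j B)⟩`;
  **`effAction_energy_dist`**: the trial field `PcoMat·harmExt_j B − harmExt_{j+1}(Rco j B)` is within `−2re⟨B, E_{j+1}(Rco j B)⟩ − re⟨Rco j B, E_{j+1}(Rco j B)⟩` of the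
  level-`(j+1)` minimiser `harmExt_{j+1} B` in the `hform (j+1)` ENERGY; **`effAction_squeeze_nsq`**: a bound `nsq (Rco j B) ≤ ρ²·nsq B` turns both into `2‖E_{j+1}‖ρ·nsq B`.
WHAT REMAINS OF R1 (its S3 + S4, numerically `ρ_j = O(Lc^{−2j})` in (P-R1c)): the estimate of `Rco j`.  NOT (CONV-C), NOT D1, NOT BetaPertH, NOT continuum, NOT Clay.
-/

noncomputable section

namespace Summit.QuantumFields.BalabanUV.Beta.GAN24.MonotoneTorusSqueeze

open Matrix Finset
open scoped BigOperators ComplexOrder Matrix.Norms.L2Operator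
open Literature.MathematicalPhysics.QuantumFieldTheory.Balaban1983to89.B5Prop11Plancherel (Tor fine unitVec)
open Literature.MathematicalPhysics.QuantumFieldTheory.Balaban1983to89.B5Prop11Lower (nsq)
open Literature.MathematicalPhysics.QuantumFieldTheory.Balaban1983to89.B5AverageCurlStokes (plaq plaq_apply)
open Literature.MathematicalPhysics.QuantumFieldTheory.Balaban1983to89.B5Composition116 (recast recast_add recast_tstep)
open Literature.MathematicalPhysics.QuantumFieldTheory.Balaban1983to89.Beta.FluctuationProjection (Jlift)
open Summit.QuantumFields.BalabanUV.T4Continuum.BalabanAveragedTowerModes (par)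
open Summit.QuantumFields.BalabanUV.Beta.GAN24.MonotoneTorusTower (Lev sread hform hform_isHermitian hform_posSemidef hform_quad scal scal_succ scal_nonneg
  curlEnergy unitVec_eq_tstep)
open Summit.QuantumFields.BalabanUV.Beta.GAN24.MonotoneTorusEffective (effAction effAction_step_mono sread_mul_Jlift)
open Summit.QuantumFields.BalabanUV.Beta.GAN24.MonotoneShorted (harmExt shortForm)
open Summit.QuantumFields.BalabanUV.Beta.GAN24.MonotoneSqueeze (rowDefect trial squeeze energy_dist_trial_le squeeze_nsq)
open Summit.QuantumFields.BalabanUV.Beta.GAN24.MultilinearProlongation (vtx vwt twR)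
open Summit.QuantumFields.BalabanUV.Beta.GAN24.CochainProlongation (icT Pco curlEnergy_Pco_le)

variable {d : ℕ} (Lc : ℕ) [NeZero Lc] (M : Fin d → ℕ) [hM : ∀ μ, NeZero (M μ)]

/-! ## §1 The prolongation read on level `j+1` and (PROL) -/

omit [NeZero Lc] hM in
/-- `Lc·Lc^j·M_ν = Lc^j·Lc·M_ν`. [folklore] -/
theorem fine_comm (j : ℕ) (ν : Fin d) : fine (Lc * Lc ^ j) M ν = fine (Lc ^ j * Lc) M ν := by
  show Lc * Lc ^ j * M ν = Lc ^ j * Lc * M ν; ring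

/-- the site identification between the prolongation's fine torus `fine (Lc·Lc^j) M` and level `j+1`'s `fine (Lc^j·Lc) M`. [folklore] -/
def castS (j : ℕ) : Tor (fine (Lc * Lc ^ j) M) ≃ Tor (fine (Lc ^ j * Lc) M) := recast (fine_comm Lc M j)

omit [NeZero Lc] hM in
/-- `castS` commutes with unit steps. [folklore] -/
theorem castS_add_unitVec (j : ℕ) (x : Tor (fine (Lc * Lc ^ j) M)) (μ : Fin d) :
    castS Lc M j (x + unitVec _ μ) = castS Lc M j x + unitVec _ μ := by
  unfold castS
  rw [recast_add, unitVec_eq_tstep, unitVec_eq_tstep, recast_tstep]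

/-- **THE COCHAIN PROLONGATION READ ON LEVEL `j+1`**: `PcoLev j A (x, ν) = Pco (Lc^j) Lc M A (castS⁻¹ x, ν)`. [folklore] -/
def PcoLev (j : ℕ) (A : Lev Lc M j → ℂ) : Lev Lc M (j + 1) → ℂ := fun i => Pco (Lc ^ j) Lc M A ((castS Lc M j).symm i.1, i.2)

omit hM in
/-- plaquettes commute with the re-indexing. [folklore] -/
theorem plaq_PcoLev (j : ℕ) (A : Lev Lc M j → ℂ) (μ ν : Fin d) (x : Tor (fine (Lc * Lc ^ j) M)) :
    plaq (fine (Lc ^ j * Lc) M) (PcoLev Lc M j A) μ ν (castS Lc M j x) = plaq (fine (Lc * Lc ^ j) M) (Pco (Lc ^ j) Lc M A) μ ν x := by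
  simp only [plaq_apply, PcoLev, ← castS_add_unitVec, Equiv.symm_apply_apply]

/-- the curl energy is invariant under the re-indexing. [folklore] -/
theorem curlEnergy_PcoLev (j : ℕ) (A : Lev Lc M j → ℂ) :
    curlEnergy (fine (Lc ^ j * Lc) M) (PcoLev Lc M j A) = curlEnergy (fine (Lc * Lc ^ j) M) (Pco (Lc ^ j) Lc M A) := by
  unfold curlEnergy
  refine sum_congr rfl fun μ _ => sum_congr rfl fun ν _ => ?_
  rw [← Equiv.sum_comp (castS Lc M j)]
  exact sum_congr rfl fun x _ => by rw [plaq_PcoLev]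

/-- `curlEnergy (PcoLev A) ≤ (Lc^d/Lc²)·curlEnergy A` (`CochainProlongation.curlEnergy_Pco_le` transported). [folklore] -/
theorem curlEnergy_PcoLev_le (j : ℕ) (A : Lev Lc M j → ℂ) :
    curlEnergy (fine (Lc ^ j * Lc) M) (PcoLev Lc M j A) ≤ (Lc : ℝ) ^ d / (Lc : ℝ) ^ 2 * curlEnergy (fine (Lc ^ j) M) A := by
  rw [curlEnergy_PcoLev]; exact curlEnergy_Pco_le (Lc ^ j) Lc M A

/-- **(PROL) FOR ROAD P4's SCALED CURL FORMS**: `re⟨PcoLev A, hform (j+1) PcoLev A⟩ ≤ re⟨A, hform j A⟩` — with the unit factor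
`scal (j+1) = scal j·Lc²/Lc^d` the factor `Lc^d/Lc²` of the prolongation cancels exactly. [folklore] -/
theorem prol (j : ℕ) (A : Lev Lc M j → ℂ) :
    (star (PcoLev Lc M j A) ⬝ᵥ (hform Lc M (j + 1) *ᵥ PcoLev Lc M j A)).re ≤ (star A ⬝ᵥ (hform Lc M j *ᵥ A)).re := by
  rw [hform_quad, hform_quad, Complex.ofReal_re, Complex.ofReal_re, scal_succ]
  have hL : (0 : ℝ) < Lc := Nat.cast_pos.mpr (Nat.pos_of_ne_zero (NeZero.ne Lc))
  have h1 := curlEnergy_PcoLev_le Lc M j A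
  have hs := scal_nonneg (d := d) Lc j
  have hc : 0 ≤ (Lc : ℝ) ^ 2 / (Lc : ℝ) ^ d := by positivity
  calc scal (d := d) Lc j * ((Lc : ℝ) ^ 2 / (Lc : ℝ) ^ d) * curlEnergy (fine (Lc ^ j * Lc) M) (PcoLev Lc M j A)
      ≤ scal (d := d) Lc j * ((Lc : ℝ) ^ 2 / (Lc : ℝ) ^ d) * ((Lc : ℝ) ^ d / (Lc : ℝ) ^ 2 * curlEnergy (fine (Lc ^ j) M) A) :=
        mul_le_mul_of_nonneg_left h1 (mul_nonneg hs hc)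
    _ = scal (d := d) Lc j * curlEnergy (fine (Lc ^ j) M) A := by field_simp

/-! ## §2 The matrix of the prolongation -/

/-- the matrix of `PcoLev j` (entries: tensor weights at the vertices of the cell of the fine site). [folklore] -/
def PcoMat (j : ℕ) : Matrix (Lev Lc M (j + 1)) (Lev Lc M j) ℂ := fun i k =>
  ∑ T ∈ (univ.erase i.2).powerset,
    (vwt (univ.erase i.2) T (twR (Lc ^ j) Lc M ((castS Lc M j).symm i.1)) : ℂ)
      * (if k = (par (Lc ^ j) Lc M ((castS Lc M j).symm i.1) + vtx (fine (Lc ^ j) M) T, i.2) then 1 else 0)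

/-- **`PcoMat j *ᵥ A = PcoLev j A`**. [folklore] -/
theorem PcoMat_mulVec (j : ℕ) (A : Lev Lc M j → ℂ) : PcoMat Lc M j *ᵥ A = PcoLev Lc M j A := by
  funext i
  simp only [mulVec, dotProduct, PcoMat, PcoLev, Pco, icT, MultilinearProlongation.icore]
  simp_rw [Finset.sum_mul]
  rw [sum_comm]
  refine sum_congr rfl fun T _ => ?_
  simp_rw [mul_assoc]
  rw [← mul_sum]
  congr 1
  simp_rw [ite_mul, one_mul, zero_mul]
  simp [Finset.sum_ite_eq']

/-! ## §3 The squeeze on the torus avatar -/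

/-- **THE ROW DEFECT OF THE PROLONGATED MINIMISER**: `Rco j := sread (j+1) · PcoMat j · harmExt_j − 1` — Bałaban's level-`(j+1)` sub-block means (1.18) of the
cochain-prolongated level-`j` minimiser, minus the datum. [folklore] -/
def Rco (j : ℕ) : Matrix (Tor M × Fin d) (Tor M × Fin d) ℂ :=
  rowDefect (hform_isHermitian Lc M j) (sread Lc M j) (Jlift (Lc ^ j) M) (sread Lc M (j + 1)) (PcoMat Lc M j)

/-- **THE SQUEEZE ON ROAD P4's TORUS AVATAR**: for every `j` and every read-out datum `B`,
`0 ≤ re⟨B,(effAction (j+1) − effAction j)B⟩ ≤ −2·re⟨B, effAction (j+1) (Rco j B)⟩` — the one-step gap of Bałaban's effective actions is controlled by the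
row defect of the Whitney-prolongated minimiser (hypothesis-free; what remains of route R1 is the SIZE of `Rco j`). [folklore] -/
theorem effAction_squeeze (j : ℕ) (B : Tor M × Fin d → ℂ) :
    0 ≤ (star B ⬝ᵥ ((effAction Lc M (j + 1) - effAction Lc M j) *ᵥ B)).re
      ∧ (star B ⬝ᵥ ((effAction Lc M (j + 1) - effAction Lc M j) *ᵥ B)).re
          ≤ -2 * (star B ⬝ᵥ (effAction Lc M (j + 1) *ᵥ (Rco Lc M j *ᵥ B))).re :=
  squeeze (hform_posSemidef Lc M j) (hform_posSemidef Lc M (j + 1)) (sread_mul_Jlift Lc M (j + 1))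
    (fun u => by rw [PcoMat_mulVec]; exact prol Lc M j u) (effAction_step_mono Lc M j) B

/-- **THE ENERGY DISTANCE ON THE TORUS AVATAR**: the trial field `w_j(B) := PcoMat·harmExt_j B − harmExt_{j+1}(Rco j B)` (the cochain-prolongated level-`j`
minimiser, row-corrected) is within `−2re⟨B, E_{j+1}(Rco j B)⟩ − re⟨Rco j B, E_{j+1}(Rco j B)⟩` of the level-`(j+1)` minimiser `harmExt_{j+1} B` in the `hform (j+1)` ENERGY. [folklore] -/
theorem effAction_energy_dist (j : ℕ) (B : Tor M × Fin d → ℂ) :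
    (star (trial (hform_isHermitian Lc M j) (hform_isHermitian Lc M (j + 1)) (sread Lc M j) (Jlift (Lc ^ j) M) (sread Lc M (j + 1))
              (Jlift (Lc ^ (j + 1)) M) (PcoMat Lc M j) *ᵥ B
            - harmExt (hform_isHermitian Lc M (j + 1)) (sread Lc M (j + 1)) (Jlift (Lc ^ (j + 1)) M) *ᵥ B) ⬝ᵥ
        (hform Lc M (j + 1) *ᵥ
          (trial (hform_isHermitian Lc M j) (hform_isHermitian Lc M (j + 1)) (sread Lc M j) (Jlift (Lc ^ j) M) (sread Lc M (j + 1))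
              (Jlift (Lc ^ (j + 1)) M) (PcoMat Lc M j) *ᵥ B
            - harmExt (hform_isHermitian Lc M (j + 1)) (sread Lc M (j + 1)) (Jlift (Lc ^ (j + 1)) M) *ᵥ B))).re
      ≤ -2 * (star B ⬝ᵥ (effAction Lc M (j + 1) *ᵥ (Rco Lc M j *ᵥ B))).re
        - (star (Rco Lc M j *ᵥ B) ⬝ᵥ (effAction Lc M (j + 1) *ᵥ (Rco Lc M j *ᵥ B))).re :=
  energy_dist_trial_le (hform_posSemidef Lc M j) (hform_posSemidef Lc M (j + 1)) (sread_mul_Jlift Lc M (j + 1))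
    (fun u => by rw [PcoMat_mulVec]; exact prol Lc M j u) (effAction_step_mono Lc M j) B

/-- **NORM FORM**: if `‖effAction (j+1)‖ ≤ Λ` and `nsq (Rco j B) ≤ ρ²·nsq B` for all `B` (`ρ ≥ 0`), then
`re⟨B,(effAction (j+1) − effAction j)B⟩ ≤ 2Λρ·nsq B` and the trial field is within `2Λρ·nsq B` of the level-`(j+1)` minimiser in energy — a second-order row
defect `ρ = O(Lc^{−2j})` (R1's S3+S4; numerically so in (P-R1c)) is the `Lc^{−2j}` rate. [folklore] -/
theorem effAction_squeeze_nsq (j : ℕ) {Λ ρ : ℝ} (hΛ : ‖effAction Lc M (j + 1)‖ ≤ Λ) (hρ : 0 ≤ ρ)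
    (hR : ∀ B : Tor M × Fin d → ℂ, nsq (Rco Lc M j *ᵥ B) ≤ ρ ^ 2 * nsq B) (B : Tor M × Fin d → ℂ) :
    (star B ⬝ᵥ ((effAction Lc M (j + 1) - effAction Lc M j) *ᵥ B)).re ≤ 2 * Λ * ρ * nsq B :=
  (squeeze_nsq (hform_posSemidef Lc M j) (hform_posSemidef Lc M (j + 1)) (sread_mul_Jlift Lc M (j + 1))
    (fun u => by rw [PcoMat_mulVec]; exact prol Lc M j u) (effAction_step_mono Lc M j) hΛ hρ hR B).1

end Summit.QuantumFields.BalabanUV.Beta.GAN24.MonotoneTorusSqueeze
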